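import Summits.QuantumFields.YangMills.Theorems.BalabanUVNodesN09AtRecord
import Literature.MathematicalPhysics.QuantumFieldTheory.Balaban1983to89.B12NodeKnitRecord9

/-!
# BalabanUVNodes ∕ N09 at the STAGE-9 record `Node00.IsRecordOfRecord₉C` — the ₉C instances of N09's (W2) closers of record
# (`BalabanUVNodesN09AtRecord`): by the SHADOW for the Stage-5 sockets (plan's (W2′)(ii)), and Stage-9-NATIVE from the three ₉ binders
# (Track A, DAG node N09 [Balaban1987RG1]; KNIT-BY-NAME seat `pub-ymgap-dag-n09-a`; def-T's `Node00/Record9.lean`, 2026-08-26)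

HONEST FRAMING.  Count-neutral kernel bookkeeping over landed modules BY NAME: `BalabanUVNodesN09AtRecord.s_N09_of_shadow₅C` ∕ `guards_of_isRecordOfRecord₅C` ∕
`b12_main_iff_of_isRecordOfRecord₅C`, `Node00.exists_isRecordOfRecord₅C_of_isRecordOfRecord₉C` ∕ `atWorld_of_isRecordOfRecord₉C` (the ₉C → ₅C-at-the-shadow refinement,
same world), `B12NodeKnitRecord9.b12_main_at_record₉C_of_leaf` (the Stage-9-native knit).  NOT a discharge of N09: the sockets ∕ binders are the B12-group pin
(conjunct 1, node00-def's object) and, for the member, [B11] Thm 1 at the record's domains + the composition clauses (Record9 binds the verbatim Stage-8 `IndA`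
slot).  Nothing of Bałaban's asserted; one finite four-torus programme at fixed ε; nothing continuum ∕ ℝ⁴ ∕ OS ∕ mass-gap ∕ Clay.  0 `sorry`, 0 `def`, standard
axioms.  Filed `--supports` item `StabilityBAtRecord` (stmt-QuantumFields-19183).

WHAT THIS FILE PROVES.  `s_N09_rec₉C_of_sockets₅` (the two Stage-5 sockets over the SHADOW records ⇒ `S_N09 (IsRecordOfRecord₉C)`); `s_N09_of_refines₉C` ∕
`s_N09_rec₉C` (every `Rec` refining ₉C ∕ ₉C itself, from the pin at the presenting Stage-9 parameters, (1.1) on the domains and `HCompT`);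
`guards_of_isRecordOfRecord₉C` (in-edges `b4 b5 b6 b7` HOLD at ₉C), `b12_main_iff_of_isRecordOfRecord₉C` (N09 at ₉C ⇔ «b8 → b9 → b10 → b11 → (b12 ∧ member)»).
-/

noncomputable section

namespace Summit.QuantumFields.YangMills.BalabanUVNodes.N09AtRecord9

open Literature.MathematicalPhysics.QuantumFieldTheory.Balaban1983to89
open Literature.MathematicalPhysics.QuantumFieldTheory.Balaban1983to89.T4Continuum (T4Family FiniteEpsData)
open Literature.MathematicalPhysics.QuantumFieldTheory.Balaban1983to89.DagBinding (WorldP leavesP)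
open Literature.MathematicalPhysics.QuantumFieldTheory.Balaban1983to89.Node00
open FlowStepRuns (genSeq)
open YMDAG.UVSplit (RecordPred Datum AtRecord S_N09)
open Summit.QuantumFields.YangMills.BalabanUVNodes.N09AtRecord
  (s_N09_of_shadow₅C guards_of_isRecordOfRecord₅C b12_main_iff_of_isRecordOfRecord₅C)

variable {N : ℕ} [NeZero N]

/-- **`S_N09` AT THE STAGE-9 RECORD from the two Stage-5 sockets OVER THE SHADOW RECORDS** (plan's (W2′)(ii): `s_N09_of_shadow₅C` at
`Node00.exists_isRecordOfRecord₅C_of_isRecordOfRecord₉C`). [cite: Balaban1987RG1, Lemma 4 (3.53) p.280, Thm 1 p.259 and Thm 3 p.264] -/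
theorem s_N09_rec₉C_of_sockets₅
    (slot12 : ∀ (F : T4Family) (D₅ : Datum F N) (w : WorldP), IsRecordOfRecord₅C F N D₅ w →
      ∀ θ : Stage5Params F N, θ.Admissible → D₅ = datumOfRecord₅ F N θ → (∀ P, w.up P = upOfRecord₅C F N θ P) →
        ∀ P : B12.RunParams, B12Sec2to5.Lemma4Printed (θ.res.X P).F12 (θ.res.X P).c12)
    (slotT : ∀ (F : T4Family) (D₅ : Datum F N) (w : WorldP), IsRecordOfRecord₅C F N D₅ w →
      ∀ θ : Stage5Params F N, θ.Admissible → D₅ = datumOfRecord₅ F N θ → w.C = D₅.C → w.γ = θ.γ → ∀ P : B12.RunParams,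
        ((datumOfRecord₅ F N θ).C P).flow.InInterval θ.γ P.K → ∀ k, k ≤ P.K → ((datumOfRecord₅ F N θ).C P).IndAss k) :
    S_N09 (fun F D w => IsRecordOfRecord₉C F N D w) :=
  s_N09_of_shadow₅C _ (fun F _ _ h => (exists_isRecordOfRecord₅C_of_isRecordOfRecord₉C (F := F) h).imp fun _ h5 => h5.1) slot12 slotT

/-- **`S_N09 Rec` FOR EVERY RECORD PREDICATE REFINING THE STAGE-9 RECORD**, Stage-9-native, from the three ₉ binders over the presenting Stage-9 parameters and their
provisos (`B12NodeKnitRecord9.b12_main_at_record₉C_of_leaf` BY NAME). [cite: Balaban1987RG1, Lemma 4 (3.53) p.280, Thm 3 p.264 and (1.1)–(1.3) p.260; Balaban1985Variational, Thm 1 p.279] -/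
theorem s_N09_of_refines₉C (Rec : RecordPred N)
    (href : ∀ (F : T4Family) (D : Datum F N) (w : WorldP), Rec F D w → IsRecordOfRecord₉C F N D w)
    (slot12 : ∀ (F : T4Family) (D : Datum F N) (w : WorldP), Rec F D w →
      ∀ θ : Stage9Params F N, ∀ h : θ.Provisos, θ.Admissible → D = datumOfRecord₉ F N θ h → w.γ ≤ θ.γ →
        (∀ P, w.up P = upOfRecord₅C F N (θ.toStage5 F N) P) → ∀ P : B12.RunParams, B12Sec2to5.Lemma4Printed (θ.res.X P).F12 (θ.res.X P).c12)
    (h11 : ∀ (F : T4Family) (D : Datum F N) (w : WorldP), Rec F D w →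
      ∀ θ : Stage9Params F N, ∀ h : θ.Provisos, θ.Admissible → D = datumOfRecord₉ F N θ h → w.γ ≤ θ.γ →
        ∀ (p : B12.RunParams) (k : ℕ), k ≤ p.K →
          ∀ V ∈ domAltOfRecord F N θ.ν p.K k, UkExists F N p.K k θ.εbg V ∧ UniqueUkOrbit F N p.K k θ.εbg V)
    (hcomp : ∀ (F : T4Family) (D : Datum F N) (w : WorldP), Rec F D w →
      ∀ θ : Stage9Params F N, ∀ h : θ.Provisos, θ.Admissible → D = datumOfRecord₉ F N θ h → w.γ ≤ θ.γ →
        ∀ (p : B12.RunParams) (k : ℕ), k ≤ p.K →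
          HCompT F N (TOfRecord F N) (chi7 F N θ.toStage8Params) θ.εbg p.K (genSeq (betaOfRecord₉ F N θ) p.g0) k
            (domAltOfRecord F N θ.ν p.K k)) :
    S_N09 Rec :=
  fun F D w hR P => B12NodeKnitRecord9.b12_main_at_record₉C_of_leaf (href F D w hR) (slot12 F D w hR) (h11 F D w hR) (hcomp F D w hR) P

/-- **`S_N09` AT THE STAGE-9 RECORD ITSELF** from the three ₉ binders. [cite: Balaban1987RG1, Lemma 4 (3.53) p.280, Thm 3 p.264 and (1.1)–(1.3) p.260] -/
theorem s_N09_rec₉C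
    (slot12 : ∀ (F : T4Family) (D : Datum F N) (w : WorldP), IsRecordOfRecord₉C F N D w →
      ∀ θ : Stage9Params F N, ∀ h : θ.Provisos, θ.Admissible → D = datumOfRecord₉ F N θ h → w.γ ≤ θ.γ →
        (∀ P, w.up P = upOfRecord₅C F N (θ.toStage5 F N) P) → ∀ P : B12.RunParams, B12Sec2to5.Lemma4Printed (θ.res.X P).F12 (θ.res.X P).c12)
    (h11 : ∀ (F : T4Family) (D : Datum F N) (w : WorldP), IsRecordOfRecord₉C F N D w →
      ∀ θ : Stage9Params F N, ∀ h : θ.Provisos, θ.Admissible → D = datumOfRecord₉ F N θ h → w.γ ≤ θ.γ →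
        ∀ (p : B12.RunParams) (k : ℕ), k ≤ p.K →
          ∀ V ∈ domAltOfRecord F N θ.ν p.K k, UkExists F N p.K k θ.εbg V ∧ UniqueUkOrbit F N p.K k θ.εbg V)
    (hcomp : ∀ (F : T4Family) (D : Datum F N) (w : WorldP), IsRecordOfRecord₉C F N D w →
      ∀ θ : Stage9Params F N, ∀ h : θ.Provisos, θ.Admissible → D = datumOfRecord₉ F N θ h → w.γ ≤ θ.γ →
        ∀ (p : B12.RunParams) (k : ℕ), k ≤ p.K →
          HCompT F N (TOfRecord F N) (chi7 F N θ.toStage8Params) θ.εbg p.K (genSeq (betaOfRecord₉ F N θ) p.g0) k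
            (domAltOfRecord F N θ.ν p.K k)) :
    S_N09 (fun F D w => IsRecordOfRecord₉C F N D w) :=
  s_N09_of_refines₉C _ (fun _ _ _ h => h) slot12 h11 hcomp

section Guards9

variable {F : T4Family} {D : FiniteEpsData F (Node00.SU N)} {w : WorldP}

/-- **In-edge guards at every run of a Stage-9 record**: `b4 b5 b6 b7` HOLD (the ₅C guards transferred by `Node00.atWorld_of_isRecordOfRecord₉C`).
[cite: Balaban1985Averaging, Props. 1–10 pp.26–50 (bookkeeping, transferred)] -/
theorem guards_of_isRecordOfRecord₉C (h : IsRecordOfRecord₉C F N D w) (P : B12.RunParams) :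
    (leavesP w P).b4 ∧ (leavesP w P).b5 ∧ (leavesP w P).b6 ∧ (leavesP w P).b7 :=
  atWorld_of_isRecordOfRecord₉C (X := fun ℓ => ℓ.b4 ∧ ℓ.b5 ∧ ℓ.b6 ∧ ℓ.b7) (fun _ _ h5 P => guards_of_isRecordOfRecord₅C h5 P) h P

/-- **At a ₉C record N09 IS «b8 → b9 → b10 → b11 → (b12 ∧ member)»** (the four discharged in-edges drop out; transferred from ₅C).
[cite: Balaban1987RG1, Lemma 4 (3.53) p.280 and Thm 3 p.264 (bookkeeping, transferred)] -/
theorem b12_main_iff_of_isRecordOfRecord₉C (h : IsRecordOfRecord₉C F N D w) (P : B12.RunParams) :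
    Dag.B12_main (leavesP w P) ↔
      ((leavesP w P).b8 → (leavesP w P).b9 → (leavesP w P).b10 → (leavesP w P).b11 →
        ((leavesP w P).b12 ∧ ((leavesP w P).b12 → (leavesP w P).b13 → ((leavesP w P).smallCouplings → (leavesP w P).smallFieldInductive)))) :=
  atWorld_of_isRecordOfRecord₉C
    (X := fun ℓ => Dag.B12_main ℓ ↔ (ℓ.b8 → ℓ.b9 → ℓ.b10 → ℓ.b11 → (ℓ.b12 ∧ (ℓ.b12 → ℓ.b13 → (ℓ.smallCouplings → ℓ.smallFieldInductive)))))
    (fun _ _ h5 P => b12_main_iff_of_isRecordOfRecord₅C h5 P) h P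

end Guards9

end Summit.QuantumFields.YangMills.BalabanUVNodes.N09AtRecord9

end
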